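import Summits.QuantumFields.BalabanUV.T4Continuum.Support.NE7OneStepOfLocalChartRatioWideDecSlice
import Summits.QuantumFields.BalabanUV.T4Continuum.Support.NE7InteriorInduction
import HarnessLib

/-!
# GEN 99 RE-THREAD (`…Slice`, Bałaban-slice road, memo `t4/b2b-balaban-t4-ne7-p1-g99/ROAD-G99.md` §3.5 ∕ §3.8): this file is `NE7HintOfLocalChartWideDec`'s CHAIN THEOREM VERBATIM except that
# the slice `T_♮(U♯) = frameFreeBlockLandauW` of the per-pair binder is replaced by an ABSTRACT SLICE FAMILY `𝒯 k U♯` with the two hypotheses (hT) «tangent-critical ⟹ critical on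
# `𝒯 j W`» and (hP) «class SlicePoincare for `𝒯 j W`» in the generic theorems, and by the corner-free energy block-Landau slice `𝒯_E = energyBlockLandauW` (both hypotheses
# DISCHARGED: `hT_energyBlockLandau`, `classSlicePoincare_energyBlockLandau_SU2`, constant `8·CPLine 4 2 2 10⁻¹⁷ 10⁻⁵³ + 1`) in the SU(2) `d = 4` `L = 2` theorems; chain predecessors are
# the `…Slice` ∕ `…GenericSlice` re-issues (lineage `b2b-balaban-t4-ne7-p1` gen 99, CRUX PROVER NE7 #1).  NOT NE7; spine 0∕9.  Original docstring follows.

# GEN 95 RE-THREAD (`…Dec`): this file is `NE7HintOfLocalChartWide` VERBATIM except that F31's per-pair binder `hleaves` (row NE3's weight currency,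
# numerically refuted for arbitrary pairs — memo `t4/b2b-balaban-t4-ne7-p1-g95/WEIGHT-CURRENCY-DEAD.md`) is replaced by F327's honest binder `hdecomp`
# (decomposition `X = X_T + X_N` with its two energy letters and k-free currencies `(α̂, ν̂, κ̂)`) and route Π's uniform block by ONE k-free line;
# the chart∕budget content is untouched and chain predecessors are the `…Dec` re-issues.  Original docstring follows.

# NE7 — (8)∃ FROM THE LOCAL CHART ON THE WIDE COVER (F285w)

[Balaban1985Variational] Thm 1 (8) ∘ Prop 8 ∘ [Balaban1983Laplace] Thm 2, row NE7.  F285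
`NE7HintOfLocalChart.hint_of_localChart` VERBATIM except that THE CHART is asked on the `Kc`-fold cover
for a FREE `Kc ≥ 4ℓ + 12` (over F284cw `NE7OneStepOfLocalChartRatioWide`), instead of the `(4ℓ+12)`-fold
cover of F282–F286, on which for small `N` (every `ℓ` at `N = 1`) the chart ball
`torusSupNorm ≤ (nbRad + 2ℓ + 10)·M` is the WHOLE torus and the hypothesis is refuted by torons (gen 91,
`NE7LocalChartCoverObstruction.not_chart_cover12`).  The consumer takes `Kc ≥ 2·nbRad (d+1) L + 4ℓ + 24`:
the chart is then LOCAL — [B8] Thm 2 at `U₀ = 1` on a proper sub-box of the cover torus.  Conclusion as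
F285: (8)∃, the `hint` binder of `NE7InteriorMinimiserDocking.hminE_of_interior_exists` ∕ route 1's END,
via `NE7InteriorInduction.hint_of_oneStep` at `δ = ε/L²`.  Bill: THE CHART (constants `≤ A(ℓ+1)^p`,
small field `r ≤ ε/L²`), row NE3's `hleaves` (at `δ₁ = ε/(2L²)`), `LevelSmall`, the slice Poincaré
inequality, route Π's two `k`-free lines.  Nothing of Bałaban's is asserted as an axiom; NE7 is NOT proved
unconditionally.
-/

open scoped BigOperators Matrix Matrix.Norms.L2Operator Topology
open NormedSpace Finset Set Filter

namespace Summit.QuantumFields.BalabanUV.T4Continuum.NE7HintOfLocalChartWideDecSlice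

open Literature.MathematicalPhysics.QuantumFieldTheory.Balaban1983to89
open B7Prop1Explicit B7Prop2Explicit MatrixLog UnitaryModel
open B4TorusKernel.MultiPeriod (torusSupNorm)
open T4AveragingDeficitWall (IsUnitaryCfg IsSkewDir SmallField vary curl curlSq dirSq dirL1)
open T4AveragingDeficitWallBoundary (IsPeriodicCfg periodBox)
open AveragingDeficitPeriodicCounting (IsPeriodicDir)
open AveragingDeficitMultiLevelPrep (LevelSmall tower TangentIter)
open BlockAverageVaryHolo (nbRad)
open MinimalActionLevels (perWin)
open MinimalActionSandwich (IsMinimiser admissible)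
open MinimalActionRate (sfClass)
open NE3HessForm (dAction)
open NE3SlicePoincareShape (SlicePoincare)
open NE7MeanZeroGaugeSliceW (energyBlockLandauW)
open NE7EnergyBlockLandauClassPoincare (classSlicePoincare_energyBlockLandau_SU2)
open NE7ConvOneStepGenericSlice (hT_energyBlockLandau)
open NE3TangentCovariantTower (dirIter)
open NE3DecomposedRepOfLinearNormalPart (ResidualSliceRepT)
open NE3QbarIterCovLiftPrep (cruxC)
open NE3SmoothRightInverseW (rightInvW)
open NE3RightInverseSolveLetters (thetaLoc)
open NE3RightInverseL2Letter (l2C)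
open NE3HatInvCurlLetters (curl2C curl1C)
open NE3EnergyShapes (IsUnitarySite)
open BlockAveragePushDirSplit (flat)
open NE7OneStepOfLocalChartRatioWideDecSlice (oneStep_of_chart_regime_ratio_wide)
open T4AveragingDeficitWall (Plaq)
open NE3EnergyWeightedShapes (energyNormW)
open NE7InteriorInduction (hint_of_oneStep)

variable {d : ℕ} {n : Type*} [Fintype n] [DecidableEq n]

set_option maxHeartbeats 400000 in
/-- **F285w — (8)∃ from the local chart on the WIDE cover.**  [Balaban1985Variational] Thm 1 (8) ∘ Prop 8 ∘
[Balaban1983Laplace] Thm 2, rows NE7 ∘ NE3: F285's statement with a free cover factor `Kc ≥ 4ℓ + 12` (the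
chart hypothesis at period `N·Kc`); proof = F285's over F284cw. -/
theorem hint_of_localChart_wide [Nonempty n] {L : ℕ} [NeZero L] (hL : 2 ≤ L) {A : ℝ} (hA : 0 ≤ A) (p : ℕ) :
    ∃ ℓ : ℕ, 1 ≤ ℓ ∧ ∃ ε₀ : ℝ, 0 < ε₀ ∧ ∀ ε : ℝ, 0 < ε → ε ≤ ε₀ → ∃ β₀ : ℝ, 0 < β₀ ∧ ∀ β : ℝ, 0 < β → β ≤ β₀ →
    ∀ (N : ℕ) [NeZero N] (Kc : ℕ) (CP C₀ C₁ αh νh κh : ℝ), 1 ≤ N → 4 * ℓ + 12 ≤ Kc → 0 < CP →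
    (∀ k : ℕ, LevelSmall (d + 1) L k (ε / ((L : ℝ) ^ (k + 1)) ^ 2)) →
    ∀ (𝒯 : ℕ → (Site (d + 1) → Fin (d + 1) → (Matrix n n ℂ)ˣ) → Set (Site (d + 1) → Fin (d + 1) → Matrix n n ℂ)),
    (∀ (j : ℕ) (W : Site (d + 1) → Fin (d + 1) → (Matrix n n ℂ)ˣ), W ∈ sfClass (d + 1) L N ε (j + 1) → ∀ F : Finset (Plaq (d + 1)),
      (∀ φ : Site (d + 1) → Fin (d + 1) → Matrix n n ℂ, IsSkewDir φ → IsPeriodicDir φ ((tower L N (j + 1) : ℕ) : ℤ) → TangentIter L j W φ → dAction W φ F = 0) →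
      ∀ Y ∈ 𝒯 j W, dAction W Y F = 0) →
    (∀ (j : ℕ) (W : Site (d + 1) → Fin (d + 1) → (Matrix n n ℂ)ˣ), W ∈ sfClass (d + 1) L N ε (j + 1) → SlicePoincare L (j + 1) W (𝒯 j W) CP (periodBox (d := d + 1) (N * L ^ (j + 1)))) →
    -- the k-free ceilings `(α̂, ν̂, κ̂)` of the honest per-pair binder and ONE k-free strict line (F327)
    2 * κh < ((((1 / 2 - νh ^ 2) / (2 * (1 + CP)) - νh ^ 2) / 2 - 576 * ((d + 1 : ℕ) : ℝ) * (αh ^ 2 * Real.exp (2 * αh))) / (Fintype.card n : ℝ) - 28 * ((d + 1 : ℕ) : ℝ) * (ε + 7 * αh ^ 2)) →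
    -- the chart constants, polynomial in `ℓ + 1`
    0 ≤ C₀ → C₀ ≤ A * ((ℓ : ℝ) + 1) ^ p → 0 ≤ C₁ → C₁ ≤ A * ((ℓ : ℝ) + 1) ^ p →
    -- THE CHART (N1)-weak at `δ = λε`: [B8] Thm 2 at `U₀ = 1` on nested cubes, TYPE (asserted for nothing here)
    (∀ D : Site (d + 1) → Fin (d + 1) → (Matrix n n ℂ)ˣ, IsUnitaryCfg D → IsPeriodicCfg D ((N * Kc) : ℤ) → SmallField D (4 * (Real.exp β - 1)) →
      ∀ (k : ℕ), ∀ U ∈ admissible (sfClass (d + 1) L (N * Kc) ε) L (k + 1) D,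
      (∀ φ : Site (d + 1) → Fin (d + 1) → Matrix n n ℂ, IsSkewDir φ → IsPeriodicDir φ (((N * Kc) * L ^ (k + 1) : ℕ) : ℤ) → TangentIter L k U φ →
        dAction U φ (perWin (d + 1) ((N * Kc) * L ^ (k + 1))) = 0) →
      ∀ r : ℝ, 0 ≤ r → r ≤ (1 / (L : ℝ) ^ 2 * ε) → SmallField U (r / ((L : ℝ) ^ (k + 1)) ^ 2) →
      ∀ z : Site (d + 1), ∃ (u : Site (d + 1) → (Matrix n n ℂ)ˣ) (At : Site (d + 1) → Fin (d + 1) → Matrix n n ℂ) (a₀ a₁ : ℝ),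
        IsUnitarySite u ∧ (∀ (y : Site (d + 1)) (i : Fin (d + 1)), u (y + (((N * Kc) * L ^ (k + 1) : ℕ) : ℤ) • e i) = u y) ∧
        IsSkewDir At ∧ IsPeriodicDir At (((N * Kc) * L ^ (k + 1) : ℕ) : ℤ) ∧ 0 ≤ a₀ ∧ 0 ≤ a₁ ∧
        (∀ (y : Site (d + 1)) (κ : Fin (d + 1)), ‖At y κ‖ ≤ a₀) ∧ (∀ (y : Site (d + 1)) (κ τ : Fin (d + 1)), ‖At (y + e τ) κ - At y κ‖ ≤ a₁) ∧
        (L : ℝ) ^ (k + 1) * a₀ ≤ C₀ * (r + 4 * (Real.exp β - 1) + ε) ∧ ((L : ℝ) ^ (k + 1)) ^ 2 * a₁ ≤ C₁ * (r + 4 * (Real.exp β - 1) + ε) ∧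
        (∀ (y : Site (d + 1)) (κ : Fin (d + 1)),
          torusSupNorm (fun _ : Fin (d + 1) => L ^ (k + 1) * (N * Kc)) (y - z) ≤ (((nbRad (d + 1) L + 2 * ℓ + 10) * L ^ (k + 1) : ℕ) : ℝ) →
            gaugeAct u U y κ = vary (flat (d := d + 1) (n := n)) At 1 y κ)) →
    -- THE HONEST PER-PAIR BINDER `hdecomp` on the data class at `δ₁ = λε/2` (F327's, dimension `d + 1`)
    (∀ D : Site (d + 1) → Fin (d + 1) → (Matrix n n ℂ)ˣ, IsUnitaryCfg D → IsPeriodicCfg D (N : ℤ) → SmallField D (4 * (Real.exp β - 1)) → ∀ (k : ℕ), ∀ Us ∈ admissible (sfClass (d + 1) L N ε) L (k + 1) D, SmallField Us ((1 / (L : ℝ) ^ 2 * ε / 2) / ((L : ℝ) ^ (k + 1)) ^ 2) → (∀ φ : Site (d + 1) → Fin (d + 1) → Matrix n n ℂ, IsSkewDir φ → IsPeriodicDir φ ((N * L ^ (k + 1) : ℕ) : ℤ) → TangentIter L k Us φ → dAction Us φ (perWin (d + 1) (N * L ^ (k + 1))) = 0) → ∀ U' ∈ admissible (sfClass (d + 1)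 L N ε) L (k + 1) D, 
      ∃ (u : Site (d + 1) → (Matrix n n ℂ)ˣ) (X XT XN : Site (d + 1) → Fin (d + 1) → Matrix n n ℂ) (α ν κ : ℝ),
        IsUnitarySite u ∧ IsSkewDir X ∧ IsPeriodicDir X ((N * L ^ (k + 1) : ℕ) : ℤ) ∧ 0 ≤ α ∧ (∀ x μ, ‖X x μ‖ ≤ α) ∧
        gaugeAct u U' = vary Us X 1 ∧
        X = XT + XN ∧ XT ∈ 𝒯 k Us ∧ IsSkewDir XN ∧ 0 ≤ ν ∧
        energyNormW L (k + 1) Us XN (periodBox (d := d + 1) (N * L ^ (k + 1)))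
          ≤ ν * energyNormW L (k + 1) Us X (periodBox (d := d + 1) (N * L ^ (k + 1))) ∧
        ε / ((L : ℝ) ^ (k + 1)) ^ 2 * (∑ p ∈ perWin (d + 1) (N * L ^ (k + 1)), ‖curl Us XN p‖)
          ≤ κ * energyNormW L (k + 1) Us X (periodBox (d := d + 1) (N * L ^ (k + 1))) ^ 2 ∧
        α * (L : ℝ) ^ (k + 1) ≤ αh ∧ ν ≤ νh ∧ κ ≤ κh) →
    ∃ δV : ℝ, 0 < δV ∧
      ∀ V ∈ {V : Site (d + 1) → Fin (d + 1) → (Matrix n n ℂ)ˣ | IsUnitaryCfg V ∧ IsPeriodicCfg V (N : ℤ) ∧ SmallField V δV},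
      ∀ k : ℕ, ∃ U : Site (d + 1) → Fin (d + 1) → (Matrix n n ℂ)ˣ, IsMinimiser (d + 1) (sfClass (d + 1) L N ε) L N k V U ∧
        ∃ a : ℝ, 0 ≤ a ∧ a < ε / ((L : ℝ) ^ k) ^ 2 ∧ SmallField U a := by
  have hL1 : (1 : ℝ) ≤ (L : ℝ) := by exact_mod_cast (le_trans one_le_two hL)
  have hL2 : (2 : ℝ) ≤ (L : ℝ) := by exact_mod_cast hL
  have hLsq : (4 : ℝ) ≤ (L : ℝ) ^ 2 := by nlinarith [hL2]
  have hl0 : (0 : ℝ) < 1 / (L : ℝ) ^ 2 := by positivity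
  have hl1 : 1 / (L : ℝ) ^ 2 < 1 := by rw [div_lt_one (by positivity)]; linarith
  obtain ⟨ℓ, hℓ1, ε₀, hε₀, H⟩ := oneStep_of_chart_regime_ratio_wide (d := d) (n := n) hL hA p hl0 hl1
  refine ⟨ℓ, hℓ1, ε₀, hε₀, fun ε hε hεle => ?_⟩
  obtain ⟨β₀, hβ₀, H2⟩ := H ε hε hεle
  refine ⟨β₀, hβ₀, ?_⟩
  intro β hβ hβle N _ Kc CP C₀ C₁ αh νh κh hN hKc hCP hls 𝒯 hT hP hline hC₀ hC₀b hC₁ hC₁b hchart hdecomp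
  obtain ⟨γ, hγ, hstep⟩ := H2 β hβ hβle N Kc CP C₀ C₁ αh νh κh hN hKc hCP hls 𝒯 hT hP hline hC₀ hC₀b hC₁
    hC₁b hchart hdecomp
  have hδ0 : (0 : ℝ) < 1 / (L : ℝ) ^ 2 * ε := mul_pos hl0 hε
  refine ⟨min γ (1 / (L : ℝ) ^ 2 * ε), lt_min hγ hδ0, ?_⟩
  have hδL : 1 / (L : ℝ) ^ 2 * ε * (L : ℝ) ^ 2 ≤ ε := by
    rw [div_mul_eq_mul_div, one_mul, div_mul_cancel₀ _ (by positivity)]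
  exact hint_of_oneStep (d := d + 1) (le_trans one_le_two hL) (le_min hγ.le hδ0.le) (min_le_right _ _)
    (mul_lt_of_lt_one_left hε hl1) hδL
    (fun V hVu hVp hVδ => hstep V hVu hVp (MinimalActionRate.SmallField.mono hVδ (min_le_left _ _)))

end Summit.QuantumFields.BalabanUV.T4Continuum.NE7HintOfLocalChartWideDecSlice
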